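import Summits.QuantumFields.YangMills.Theorems.BalabanUVNodesN15KingModelThm33AtRegularFieldRegionUnit
import Summits.QuantumFields.YangMills.Theorems.BalabanUVNodesN15KingModelThm33AtRegularFieldRegionFine
import Summits.QuantumFields.YangMills.Theorems.BalabanUVNodesN15KingModelB9Thm315AtRegularField

/-!
# Route «BalabanUVNodes», node N15 = NE2 — THE KING-MODEL RUNG, PART Θ⁺⁺-d (assembly): KING 1986 THEOREM 3.3 **BY NAME AT A REGULAR BACKGROUND
# `A ≠ 0` ON A BIG-BLOCK REGION `Ω ⊊ T_ε` — THE `δ`-CLAUSES LIVE** (observation points and sources on the `R₀`-interior of `Ω`), assembled BY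
# NAME from the tree's proofs of [Ba1] Propositions 2.1–2.3 for regions at a regular field ([Ba4] Theorem (1.9)–(1.12), Prop. 2.3)

Cell `pub-ymgap`, Track A (D-0062), seat `pub-ymgap-dag-n15-e` (R141 (C), s3), generation 21; sequel of PART Θ⁺ (`…N15KingModelThm33AtRegularField`,
p676497: `Ω = T_ε`, `δ`-clauses vacuous).  `bears_on: R4∕N15`; `--supports stmt-QuantumFields-27366` (K3⁸, `--as helper`).  COUNT-NEUTRAL.
Namespace `Summit.QuantumFields.YangMills.BalabanUVNodes.N15KingModelRung.Curved`.

THE PRINT.  [King1986] Theorem 3.3 pp. 655–656 (verbatim in `ContinuumLimit.Thm33Printed`): *«… Finally, define δC^{(k)}(Ω, A) = C^{(k)}(Ω, A) −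
C^{(k)}(A) and δG_k(Ω, A) = G_k(Ω, A) − G_k(A); then for x, y ∈ Ω_η, δC^{(k)}(Ω, A) and δG_k(Ω, A) satisfy the bounds (3.6) and (3.7)–(3.8) respectively,
with the additional factors exp[−δ₀ dist({x, y}, ∂Ω)] and exp[−δ₀ dist({x, y}, ∂Ω) − δ₀ dist(supp f, ∂Ω)] respectively on the right-hand sides.
Theorem 3.3 is proved in [Ba 4].»*  [Ba1] = [Balaban1982Higgs1] Prop. 2.1 (2.24)–(2.26) p. 610 *«for x, x′ ∈ Ω and satisfying the condition
dist({x, x′}, Ωᶜ) ≧ R₀»*, Prop. 2.2 (2.27) p. 611, Prop. 2.3 (2.34)–(2.38) pp. 611–612; [Ba4] = [Balaban1983RegularityDecay] Theorem p. 573.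

WHAT THIS FILE PROVES (0 `sorry`, no `def`; the datum `kingThm33DataOn C P k Ω V A a m²` (here `V = intSet k K₀ Ω`) and the region geometry — `unitRegion = Ω^{(k)}`, the `R₀`-interior sites
`IntSite k K₀ Ω`, `USite k Ω`, `extI`, `sdistI`, `bdistΩ`, `sbdistI`, `regTower` — are PART Θ⁺⁺-a `…RegionDatum`; the clauses are PARTS Θ⁺⁺-b∕c).
* ★★★ **`thm33Printed_king_regularField_region`**: for `L` odd `> 1`, `d ≥ 1`, `a, m² > 0`, `N`, `(e, q)`: there are `K₀min` and `t(K₀) > 0` such that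
  for every cube size `K₀ ≥ K₀min` with `L ∣ K₀`, every cubic torus (`Shape P`, `K₀ ∣ M`, `3K₀ ≤ 2M`), every level `1 ≤ k < K_P` with `L^kε ≤ 1`, every
  big-block union `Ω` (`IsBigBlockUnion k K₀ Ω`) and every field `A` with one-step differences `≤ δ`, `L^k·δ·|e| ≤ t(K₀)`:
  `Thm33Printed (kingThm33DataOn C P k Ω (intSet k K₀ Ω) A a m²)` — (3.6) ⇐ r14 `B1Prop23RegularRegion.ineq227_regular_region_uniform` ((2.27) on `Ω`),
  `B1Prop23RegularRegionSmall.prop23_regular_region_small` ((2.34) on `Ω`); the `δC` clause ⇐ `B1Ineq238RegularRegionSmall.prop23_238_regular_region_small`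
  ((2.38), `Ω ⊂ T`) + `B1Props21to23RegularTorus.ineq234_236_regular_torus_std` ((2.36) on `T`); (3.7)–(3.8) on `Ω` ⇐ p35 `B1Ineq225RegularRegion.
  norm_propagatorK_region_reg_decay_sum`, `B1Ineq225DerivRegularRegion.norm_covDeriv_propagatorK_region_reg_decay_sum`, `B1Ineq224RegularRegion.
  norm_holder_propagatorK_region_reg_decay_sum` ((2.24)–(2.25) under `R₀`); the `δG` clauses ⇐ `B1Ineq226RegularRegionSum.deltaG_region_reg_decay_sum`,
  `B1Ineq226HolderRegularRegion.holder_deltaG_region_reg_decay_sum` ((2.26) under `R₀`, `Ω₀ = T_ε`).  Assembled from `region_unit_clauses` (PART Θ⁺⁺-b) and `region_fine_clauses`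
  (PART Θ⁺⁺-c) with `C = max`, `δ₀ = min` of their monotone-ready constants.  Nothing re-proved.

HONEST FRAMING ∕ SCOPE.  (i) A KNIT; no estimate is new.  (ii) THE `R₀`-INTERIOR READING: the fine-site type of the datum is the set of sites of `Ω` at
distance `≥ R₀ = 2r_S + 2M(d+1) + 1` (fine steps) from `Ωᶜ`, and sources `f` live on it — this is [Ba1]∕[Ba4]'s printed restriction *«for x, x′ ∈ Ω and
satisfying the condition dist({x, x′}, Ωᶜ) ≥ R₀»* for GENERAL big-block regions; King states Theorem 3.3 for PARALLELEPIPEDS, where [Ba4] waives the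
restriction — that waiver is NOT used here (the tree has it for (2.24)–(2.25) on boxes, `B1Ineq224∕225RegularBox`, not for (2.26)), so near `∂Ω` this file
says nothing; the interior is nonempty only when `Ω` contains a ball of radius `R₀` (≳ `4(d+1)+3` big blocks across) — for thinner regions the
fine-lattice clauses are vacuous, while the unit-lattice clauses ((3.6), `δC`) are stated on ALL of `Ω^{(k)}` and are never vacuous for `Ω ≠ ∅`.  (iii) `Ω` a union of big blocks (`K₀L^k`-cubes) with `L ∣ K₀` (so `Ω^{(k)}` is a union of `L`-blocks, r14's (2.34) hypothesis); cubic tori of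
r14's sub-family; `L` odd `≥ 3`; `m² > 0`; `1 ≤ k < K_P`; `L^kε ≤ 1`; constants existential per `K₀`.  (iv) `Ω = T_ε` is allowed (then this is PART Θ⁺ again
with interior = everything).  NOT Bałaban's non-abelian `G(U)` of [B9]; NE2⁺ NOT printed ∕ not proved; NOT a node discharge; counts untouched; nothing
continuum ∕ ℝ⁴ ∕ OS ∕ mass-gap ∕ Clay.
-/

noncomputable section

namespace Summit.QuantumFields.YangMills.BalabanUVNodes.N15KingModelRung.Curved

open Literature.MathematicalPhysics.QuantumFieldTheory.Balaban1983to89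
open Literature.MathematicalPhysics.QuantumFieldTheory.Balaban1983to89.HiggsLattice (ChargeData)
open Literature.MathematicalPhysics.QuantumFieldTheory.Balaban1983to89.B1Eq211ZeroFieldTorus (Shape)
open Literature.MathematicalPhysics.QuantumFieldTheory.Balaban1983to89.B1TorusRegionHSizes (IsBigBlockUnion isBigBlockUnion_univ)
open Literature.MathematicalPhysics.QuantumFieldTheory.Balaban1983to89.B3Ineq211RegularTorus (IsAdm)
open Literature.MathematicalPhysics.QuantumFieldTheory.King1986.ContinuumLimit (Thm33Data Thm33Printed IsRegular35)

variable {N : ℕ}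

/-- ★★★ **KING 1986 THEOREM 3.3 BY NAME AT A REGULAR BACKGROUND ON A BIG-BLOCK REGION `Ω ⊂ T_ε`, TRANSPORTS ALONG ANY ADMISSIBLE CONTOUR
SYSTEM `Γ` — THE `δ`-CLAUSES LIVE** (the `R₀`-interior reading; statement and sources in the module docstring).
[cite: King1986, Thm 3.3 (3.6)–(3.8) pp.655–656] [cite: Balaban1982Higgs1, Prop. 2.1 (2.24)–(2.26) p.610, Prop. 2.3 (2.34)–(2.38) pp.611–612] -/
theorem thm33Printed_king_regularField_region_along (d L : ℕ) (hd : 1 ≤ d) (hL : Odd L ∧ 1 < L) {a msq : ℝ} (ha : 0 < a) (hmsq : 0 < msq)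
    (N : ℕ) (C : ChargeData N) :
    ∃ K₀min : ℕ, ∀ K₀ : ℕ, K₀min ≤ K₀ → L ∣ K₀ → ∃ t : ℝ, 0 < t ∧
      ∀ (P : HiggsLattice.Params) (_S : Shape P), P.d = d → P.L = L → K₀ ∣ P.M → 3 * K₀ ≤ 2 * P.M →
      ∀ {k : ℕ}, 1 ≤ k → k < P.K → P.mesh k ≤ 1 →
      ∀ (Ω : Finset (HiggsLattice.Site P 0)), IsBigBlockUnion k K₀ Ω →
      ∀ (Γ : HiggsLattice.Site P 0 → HiggsLattice.Site P 0 → List (HiggsLattice.Site P 0)), (∀ y x, IsAdm y x (Γ y x)) →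
      ∀ (A : HiggsLattice.VecField P 0) {δ : ℝ}, 0 ≤ δ →
        (∀ (z : HiggsLattice.Site P 0) (μ ν : Fin P.d), |A ⟨z.shift ν, μ⟩ - A ⟨z, μ⟩| ≤ δ) →
        (P.L : ℝ) ^ k * δ * |C.e| ≤ t →
        Thm33Printed (kingThm33DataAlong C P k Ω (intSet k K₀ Ω) Γ A a msq) := by
  obtain ⟨Ku, hU⟩ := region_unit_clauses d L hL ha hmsq N C
  obtain ⟨Kf, hF⟩ := region_fine_clauses d L hd hL ha hmsq N C
  refine ⟨max Ku Kf, fun K₀ hK₀ hLK₀ => ?_⟩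
  obtain ⟨tu, htu, hU'⟩ := hU K₀ ((le_max_left _ _).trans hK₀) hLK₀
  obtain ⟨tf, htf, hF'⟩ := hF K₀ ((le_max_right _ _).trans hK₀)
  refine ⟨min tu tf, lt_min htu htf, ?_⟩
  intro P S hPd hPL hK₀M h3M k hk1 hkK hs Ω hΩbig Γ hΓ A δ hδ hreg ht
  obtain ⟨Cu, δu, _hCu, hδu, hU''⟩ := hU' P S hPd hPL hK₀M h3M hk1 hkK hs Ω hΩbig (intSet k K₀ Ω) Γ A hδ hreg (ht.trans (min_le_left _ _))
  obtain ⟨Cf, δf, _hCf, hδf, hF''⟩ := hF' P hPd hPL hK₀M h3M hk1 hkK hs Ω hΩbig (intSet k K₀ Ω) Γ hΓ A hδ hreg (ht.trans (min_le_right _ _))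
  obtain ⟨h36a, h36b, hδC⟩ := hU'' (max Cu Cf) (min δu δf) (le_max_left _ _) (lt_min hδu hδf) (min_le_left _ _)
  obtain ⟨h37a, h37b, h38, hδG, hδDG, hδH⟩ :=
    hF'' (max Cu Cf) (min δu δf) (le_max_right _ _) (lt_min hδu hδf) (min_le_right _ _) _ rfl
  exact ⟨min δu δf, 1 / 2, max Cu Cf, lt_min hδu hδf, by norm_num, by norm_num, h36a, h36b, fun f x => h37a f x x.2,
    fun μ f x => h37b μ f x x.2, fun μ f x y hxy => h38 μ f x y hxy x.2 y.2, hδC, fun f x => hδG f x x.2,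
    fun μ f x => hδDG μ f x x.2, fun μ f x y hxy => hδH μ f x y hxy x.2 y.2⟩

/-- ★★★ **KING 1986 THEOREM 3.3 BY NAME AT A REGULAR BACKGROUND ON A BIG-BLOCK REGION `Ω ⊂ T_ε` — THE `δ`-CLAUSES LIVE** (statement and sources in
the module docstring; transports along Θ⁺'s torus staircases `contourK`): for every cube size `K₀ ≥ K₀min` with `L ∣ K₀` there is `t > 0` such that for
every cubic torus of r14's sub-family with `K₀ ∣ M`, `3K₀ ≤ 2M`, every level `1 ≤ k < K_P` with `L^kε ≤ 1`, every big-block union `Ω` and every field `A`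
with one-step differences `≤ δ`, `L^k·δ·|e| ≤ t`: `Thm33Printed (kingThm33DataOn C P k Ω (intSet k K₀ Ω) A a m²)`, `α = ½`.
[cite: King1986, Thm 3.3 (3.6)–(3.8) pp.655–656] [cite: Balaban1982Higgs1, Prop. 2.1 (2.24)–(2.26) p.610, Prop. 2.2 (2.27) p.611, Prop. 2.3 (2.34)–(2.38) pp.611–612]
[cite: Balaban1983RegularityDecay, Theorem (1.9)–(1.12) p.573, Prop. 2.3 (1.15)–(1.20) p.574] -/
theorem thm33Printed_king_regularField_region (d L : ℕ) (hd : 1 ≤ d) (hL : Odd L ∧ 1 < L) {a msq : ℝ} (ha : 0 < a) (hmsq : 0 < msq)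
    (N : ℕ) (C : ChargeData N) :
    ∃ K₀min : ℕ, ∀ K₀ : ℕ, K₀min ≤ K₀ → L ∣ K₀ → ∃ t : ℝ, 0 < t ∧
      ∀ (P : HiggsLattice.Params) (_S : Shape P), P.d = d → P.L = L → K₀ ∣ P.M → 3 * K₀ ≤ 2 * P.M →
      ∀ {k : ℕ}, 1 ≤ k → k < P.K → P.mesh k ≤ 1 →
      ∀ (Ω : Finset (HiggsLattice.Site P 0)), IsBigBlockUnion k K₀ Ω →
      ∀ (A : HiggsLattice.VecField P 0) {δ : ℝ}, 0 ≤ δ →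
        (∀ (z : HiggsLattice.Site P 0) (μ ν : Fin P.d), |A ⟨z.shift ν, μ⟩ - A ⟨z, μ⟩| ≤ δ) →
        (P.L : ℝ) ^ k * δ * |C.e| ≤ t →
        Thm33Printed (kingThm33DataOn C P k Ω (intSet k K₀ Ω) A a msq) := by
  obtain ⟨K₀min, h⟩ := thm33Printed_king_regularField_region_along d L hd hL ha hmsq N C
  refine ⟨K₀min, fun K₀ hK₀ hLK₀ => ?_⟩
  obtain ⟨t, ht, h'⟩ := h K₀ hK₀ hLK₀
  refine ⟨t, ht, fun P S hPd hPL hK₀M h3M k hk1 hkK hs Ω hΩbig A δ hδ hreg hle => ?_⟩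
  rw [kingThm33DataOn_eq_along]
  exact h' P S hPd hPL hK₀M h3M hk1 hkK hs Ω hΩbig (fun y x => contourK y x) (fun y x => contourK_spec y x) A hδ hreg hle

/-- The torus case `Ω = T_ε` is an instance (then the interior is everything and the `δ`-operators vanish termwise): the hypotheses of
`thm33Printed_king_regularField_region` are met by `Ω = T_ε` for every admissible torus, level and field — in particular the family of data it
speaks about is nonempty whenever r14's sub-family is (cf. PART Θ⁺-b `thm33_family_nonempty`). [cite: King1986, Thm 3.3 p.656] -/
theorem thm33Printed_king_regularField_region_univ (d L : ℕ) (hd : 1 ≤ d) (hL : Odd L ∧ 1 < L) {a msq : ℝ} (ha : 0 < a) (hmsq : 0 < msq)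
    (N : ℕ) (C : ChargeData N) :
    ∃ K₀min : ℕ, ∀ K₀ : ℕ, K₀min ≤ K₀ → L ∣ K₀ → ∃ t : ℝ, 0 < t ∧
      ∀ (P : HiggsLattice.Params) (_S : Shape P), P.d = d → P.L = L → K₀ ∣ P.M → 3 * K₀ ≤ 2 * P.M →
      ∀ {k : ℕ}, 1 ≤ k → k < P.K → P.mesh k ≤ 1 →
      ∀ (A : HiggsLattice.VecField P 0) {δ : ℝ}, 0 ≤ δ →
        (∀ (z : HiggsLattice.Site P 0) (μ ν : Fin P.d), |A ⟨z.shift ν, μ⟩ - A ⟨z, μ⟩| ≤ δ) →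
        (P.L : ℝ) ^ k * δ * |C.e| ≤ t →
        Thm33Printed (kingThm33DataOn C P k Finset.univ (intSet k K₀ (Finset.univ : Finset (HiggsLattice.Site P 0))) A a msq) := by
  obtain ⟨K₀min, h⟩ := thm33Printed_king_regularField_region d L hd hL ha hmsq N C
  refine ⟨K₀min, fun K₀ hK₀ hLK₀ => ?_⟩
  obtain ⟨t, ht, h'⟩ := h K₀ hK₀ hLK₀
  exact ⟨t, ht, fun P S hPd hPL hK₀M h3M k hk1 hkK hs A δ hδ hreg hle =>
    h' P S hPd hPL hK₀M h3M hk1 hkK hs Finset.univ isBigBlockUnion_univ A hδ hreg hle⟩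

/-- ★★ PART Θ⁺⁺ WITH KING's DEFINITION 3.2 (3.5) BY NAME as the regularity hypothesis (`ContinuumLimit.IsRegular35` on the whole torus `T_η`,
`η > 0`; its one-step form is PART Θ⁺-b `oneStep_of_isRegular35`): the smallness is then `L^k·η·C(e s^{2−d∕2})^{β−1}·|e| ≤ t`.
[cite: King1986, Def. 3.2 (3.5) p.655, Thm 3.3 p.656] -/
theorem thm33Printed_king_region_of_isRegular35 (d L : ℕ) (hd : 1 ≤ d) (hL : Odd L ∧ 1 < L) {a msq : ℝ} (ha : 0 < a) (hmsq : 0 < msq)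
    (N : ℕ) (C : ChargeData N) :
    ∃ K₀min : ℕ, ∀ K₀ : ℕ, K₀min ≤ K₀ → L ∣ K₀ → ∃ t : ℝ, 0 < t ∧
      ∀ (P : HiggsLattice.Params) (_S : Shape P), P.d = d → P.L = L → K₀ ∣ P.M → 3 * K₀ ≤ 2 * P.M →
      ∀ {k : ℕ}, 1 ≤ k → k < P.K → P.mesh k ≤ 1 →
      ∀ (Ω : Finset (HiggsLattice.Site P 0)), IsBigBlockUnion k K₀ Ω →
      ∀ (A : HiggsLattice.VecField P 0) {η Cc e s β : ℝ}, 0 < η → IsRegular35 P 0 Set.univ η Cc e s β A →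
        (P.L : ℝ) ^ k * (η * (Cc * (e * s ^ (2 - (P.d : ℝ) / 2)) ^ (β - 1))) * |C.e| ≤ t →
        Thm33Printed (kingThm33DataOn C P k Ω (intSet k K₀ Ω) A a msq) := by
  obtain ⟨K₀min, h⟩ := thm33Printed_king_regularField_region d L hd hL ha hmsq N C
  refine ⟨K₀min, fun K₀ hK₀ hLK₀ => ?_⟩
  obtain ⟨t, ht, h'⟩ := h K₀ hK₀ hLK₀
  exact ⟨t, ht, fun P S hPd hPL hK₀M h3M k hk1 hkK hs Ω hΩbig A η Cc e s β hη hreg hsmall =>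
    h' P S hPd hPL hK₀M h3M hk1 hkK hs Ω hΩbig A (mul_nonneg hη.le (isRegular35_rhs_nonneg hreg)) (oneStep_of_isRegular35 hη hreg) hsmall⟩

/-- NON-VACUITY OF THE FAMILY: above every cube-size threshold there is an admissible cube size `K₀ = L^r` with `L ∣ K₀`, a cubic torus and a level
meeting all the side conditions of `thm33Printed_king_regularField_region` (the member of PART Θ⁺-b `higgsCovIdx_nonempty`; regions: at least `Ω = T_ε`
and `Ω = ∅` are big-block unions on every torus). [folklore] -/
theorem thm33_region_family_nonempty (d L K₀min : ℕ) (hd : 1 ≤ d) (hL : Odd L ∧ 1 < L) :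
    ∃ K₀ : ℕ, K₀min ≤ K₀ ∧ L ∣ K₀ ∧ ∃ (P : HiggsLattice.Params) (_S : Shape P) (k : ℕ),
      P.d = d ∧ P.L = L ∧ K₀ ∣ P.M ∧ 3 * K₀ ≤ 2 * P.M ∧ 1 ≤ k ∧ k < P.K ∧ P.mesh k ≤ 1 ∧
      IsBigBlockUnion k K₀ (Finset.univ : Finset (HiggsLattice.Site P 0)) := by
  obtain ⟨i⟩ := higgsCovIdx_nonempty d L (max K₀min 1) hd hL
  refine ⟨L ^ max K₀min 1, (le_max_left _ _).trans (Nat.lt_pow_self hL.2).le,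
    dvd_pow_self L (Nat.pos_iff_ne_zero.1 (Nat.lt_of_lt_of_le Nat.zero_lt_one (le_max_right _ _))),
    i.P, i.S, i.k, i.hPd, i.hPL, i.hK₀M, i.h3M, i.hk1, i.hkK, i.hmesh, isBigBlockUnion_univ⟩

end Summit.QuantumFields.YangMills.BalabanUVNodes.N15KingModelRung.Curved

end
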